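import Literature.AlgebraicGeometry.Motives.AbelianVarietyFieldPoint
import HarnessLib

/-!
# Left-invariant derivations of an abelian variety via dual-number points

Topic `Literature/AlgebraicGeometry/Motives`, namespace
`Literature.AlgebraicGeometry.Motives.AbelianVariety`. Theorems and auxiliary definitions (no named
fact; net Literature debt 0). Fifth file of route D′ towards `Mumford1970_cotangentSheaf_abelianVariety_free`
(Görtz–Wedhorn II Prop. 27.15; Mumford AV §4 (iii): «`Ω¹_X` is a free `𝒪_X`-module generated by the
invariant differentials» — dually, the invariant vector fields). For a linear form `ℓ` on `𝔪_e/𝔪_e²`: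

* `fieldPull hU ℓ : Γ(A, U) →+* Γ(A, U)[ε]` — pull-back along the field point `x ↦ x · t_ℓ` of the affine
  open `U` (`Motives/AbelianVarietyFieldPoint`); `fst_fieldPull` (`= id` modulo `ε`);
* **`invDerivApp hU ℓ : Γ(A, U) → Γ(A, U)`** — its `ε`-part, THE LEFT-INVARIANT DERIVATION `D_ℓ` on an
  affine open (Görtz–Wedhorn II, Prop. 17.43 / (17.6.1): lifts along `U[ε] → U` are derivations): additive
  (`invDerivApp_add`), Leibniz (`invDerivApp_mul`), kills the constants `secHom U c` (`invDerivApp_secHom`),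
  natural in the affine open (`fieldPt_res`, **`invDerivApp_res`**);
* `evalPt x ξ hξ hxU : Γ(A, U) →+* L` — evaluation at an `L`-point `ξ` based at `x ∈ U`;
  **`evalPt_invDerivApp`**: `(D_ℓ b)(ξ) = ∂_{ξ₀ · t_ℓ}(b_x)` — the value of `D_ℓ b` at `ξ` is the translated
  point derivation (`Motives/AbelianVarietyTranslatedDerivations`) of the germ of `b`
  (`specOfMap_evalPt_comp_fieldPt`: naturality of the Yoneda group structure along `Spec L[ε] → Spec Γ(A,U)[ε]`);
* **`invDeriv ℓ U : Γ(A, U) → Γ(A, U)` for EVERY open `U`** — the unique extension from the basis of affine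
  opens (Mathlib `TopCat.Sheaf.restrictHomEquivHom`), `invDeriv_eq_invDerivApp`, `invDeriv_map`,
  `invDeriv_add`, `invDeriv_mul`, `invDeriv_secHom` (locality: `eq_of_res_affine_eq`).

Presearch: [corpus: book:gortz2023 p. 59 Prop. 17.43 / (17.6.1) `𝒯_{X/S}(U) = Der_S(𝒪_X|_U, 𝒪_X|_U)`,
p. 806 Rem. 27.18 (4), p. 799 Rem. 27.1; Mumford AV §4 (iii) p. 42 not held (locator as printed in
`Motives/AbelianVarietyCotangentSheafFree`)]; `lit search --hybrid` / `vsearch`: GW II pp. 805–806, Bosch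
AGCA p. 409; galaxy «invariant derivations|invariant differential forms|Lie algebra of a group scheme»: no
usable hit. Mathlib searched and used: `TopCat.Sheaf.restrictHomEquivHom`/`extend_hom_app`,
`TopCat.Presheaf.isSheaf_iff_isSheaf_comp`, `TopCat.Sheaf.eq_of_locally_eq'`, `Opens.IsBasis.exists_subset_of_mem_open`,
`Scheme.isBasis_affineOpens`, `IsAffineOpen.map_fromSpec`, `TypeCat.ofHom`, `TrivSqZeroExt.snd_mul`; in this tree:
everything of `Motives/AbelianVarietyFieldPoint`, `dualNumberMap` (+ lemmas), `translatedDerivation`,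
`liftPt`, `tangentPtOfAlg`. No `instance` is declared.

## References

* [GortzWedhorn2023] U. Görtz, T. Wedhorn, *Algebraic Geometry II* (2023): Prop. 17.43 / (17.6.1) (p. 59),
  Rem. 27.1 (p. 799), Rem. 27.18 (4) and (27.4.6) (p. 806), Prop. 27.15 (p. 805).
* [MumfordAV1970] D. Mumford, *Abelian Varieties* (1970), §4 (iii) (p. 42).
* [GortzWedhorn2020] U. Görtz, T. Wedhorn, *Algebraic Geometry I*, 2nd ed. (2020): (3.4)–(3.5), (6.4).
-/

universe u

open CategoryTheory AlgebraicGeometry Opposite TopologicalSpace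
open scoped MonObj

noncomputable section

set_option backward.isDefEq.respectTransparency false

namespace Literature.AlgebraicGeometry.Motives

namespace AbelianVariety

open TrivSqZeroExt AlgPoints

variable {K : Type u} [Field K] {A : AbelianVariety K}

/-! ### The invariant derivation on the sections over an affine open -/

section AffineDerivation

variable {U : A.X.left.Opens} (hU : IsAffineOpen U)

variable (ℓ : stalkOrigin A →+ K)
  (hℓs : ∀ (c : K) (a : stalkOrigin A), ℓ (stalkOriginAlgebraMap A c * a) = c * ℓ a)
  (hℓK : ∀ c : K, ℓ (stalkOriginAlgebraMap A c) = 0)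
  (hℓ2 : ∀ x ∈ IsLocalRing.maximalIdeal (stalkOrigin A) ^ 2, ℓ x = 0)

/-- `pullSec` does not depend on the presentation of the point. [cite: GortzWedhorn2020, (3.4)–(3.5) (schemes over a ring; Hartshorne II Ex. 2.4)] -/
theorem pullSec_congr {R : CommRingCat.{u}} {q q' : Spec R ⟶ A.X.left} (e : q = q') (V : A.X.left.Opens)
    (h : ⊤ ≤ q ⁻¹ᵁ V) (h' : ⊤ ≤ q' ⁻¹ᵁ V) (b : Γ(A.X.left, V)) : pullSec q V h b = pullSec q' V h' b := by
  subst e; rfl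

/-- Pulling back a CONSTANT `c ∈ K` along a `K`-morphism `q : Spec R → A` (structure map `s'`) gives
`s'(c)`. [cite: GortzWedhorn2020, (3.4)–(3.5) (schemes over a ring; Hartshorne II Ex. 2.4)] -/
theorem pullSec_secHom {R : Type u} [CommRing R] {s' : K →+* R} (q : specOf K s' ⟶ A.X)
    {V : A.X.left.Opens} (h : ⊤ ≤ q.left ⁻¹ᵁ V) (c : K) : pullSec q.left V h (secHom V c) = s' c := by
  have w : q.left ≫ A.X.hom = Spec.map (CommRingCat.ofHom s') := Over.w q
  have h1 : secHom V c = A.X.left.presheaf.map (homOfLE le_top).op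
      (A.X.hom.appTop ((Scheme.ΓSpecIso (.of K)).inv c)) := rfl
  have htop : ⊤ ≤ q.left ⁻¹ᵁ ⊤ := le_top
  rw [h1, pullSec_map q.left le_top htop h]
  have a : q.left.appLE ⊤ ⊤ htop = q.left.appTop := Scheme.Hom.appLE_eq_app _
  change ((Scheme.ΓSpecIso (.of K)).inv ≫ (A.X.hom.appTop ≫ q.left.appLE ⊤ ⊤ htop) ≫
    (Scheme.ΓSpecIso _).hom) c = s' c
  rw [a, ← Scheme.Hom.comp_appTop, w, Scheme.ΓSpecIso_naturality, Iso.inv_hom_id_assoc]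
  rfl

/-- **The pull-back along the field point**: `b ↦ (x ↦ b(x · t_ℓ))`, a ring homomorphism
`Γ(A, U) → Γ(A, U)[ε]` (Görtz–Wedhorn II, Prop. 17.43: a morphism `U[ε] → A` restricting to the
inclusion on `U` is a derivation). [cite: GortzWedhorn2023, Prop. 17.43 and Rem. 27.18 (4)] -/
def fieldPull : Γ(A.X.left, U) →+* DualNumber Γ(A.X.left, U) :=
  pullSec (fieldPt hU ℓ hℓs hℓK hℓ2).left U (fieldPt_preimage hU ℓ hℓs hℓK hℓ2)

/-- The constant part of `fieldPull b` is `b` (the field point reduces to the chart point). [cite: GortzWedhorn2023, Prop. 17.43 and Rem. 27.18 (4)] -/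
theorem fst_fieldPull (b : Γ(A.X.left, U)) : (fieldPull hU ℓ hℓs hℓK hℓ2 b).fst = b := by
  have hc : ⊤ ≤ (chartPt hU).left ⁻¹ᵁ U := hU.fromSpec_preimage_self.ge
  have e : (chartPt hU).left = Spec.map (CommRingCat.ofHom
      (fstHom Γ(A.X.left, U) Γ(A.X.left, U) Γ(A.X.left, U)).toRingHom) ≫ (fieldPt hU ℓ hℓs hℓK hℓ2).left := by
    rw [← secAug_comp_fieldPt hU ℓ hℓs hℓK hℓ2]; rfl
  change (fstHom Γ(A.X.left, U) Γ(A.X.left, U) Γ(A.X.left, U)).toRingHom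
    (pullSec (fieldPt hU ℓ hℓs hℓK hℓ2).left U _ b) = b
  rw [← RingHom.comp_apply,
    ← CommRingCat.hom_ofHom (fstHom Γ(A.X.left, U) Γ(A.X.left, U) Γ(A.X.left, U)).toRingHom,
    ← pullSec_SpecMap_comp _ _ U (fieldPt_preimage hU ℓ hℓs hℓK hℓ2) (by rw [← e]; exact hc),
    ← pullSec_congr e U hc]
  exact pullSec_fromSpec hU hc b

/-- **The invariant derivation on the sections over an affine open `U`**: `D_ℓ(b)` is the `ε`-part
of `b(x · t_ℓ)`, i.e. the derivative of `b` along the left-invariant vector field of the tangent vector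
`t_ℓ` (Görtz–Wedhorn II, Prop. 17.43 / (17.6.1): `𝒯_{X/S}(U) = Der_S(𝒪_X|_U, 𝒪_X|_U)` via `U[ε]`-points;
Mumford AV §4 (iii): invariant vector fields). [cite: GortzWedhorn2023, Prop. 17.43 and Rem. 27.18 (4)] [cite: MumfordAV1970, §4 (iii) (p. 42)] -/
def invDerivApp (b : Γ(A.X.left, U)) : Γ(A.X.left, U) := (fieldPull hU ℓ hℓs hℓK hℓ2 b).snd

/-- `D_ℓ` is additive. [cite: GortzWedhorn2023, Prop. 17.43 and Rem. 27.18 (4)] -/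
theorem invDerivApp_add (a b : Γ(A.X.left, U)) :
    invDerivApp hU ℓ hℓs hℓK hℓ2 (a + b) = invDerivApp hU ℓ hℓs hℓK hℓ2 a + invDerivApp hU ℓ hℓs hℓK hℓ2 b := by
  rw [invDerivApp, invDerivApp, invDerivApp, map_add, snd_add]

/-- `D_ℓ(0) = 0`. [cite: GortzWedhorn2023, Prop. 17.43 and Rem. 27.18 (4)] -/
theorem invDerivApp_zero : invDerivApp hU ℓ hℓs hℓK hℓ2 0 = 0 := by
  rw [invDerivApp, map_zero, snd_zero]

/-- **Leibniz rule**: `D_ℓ(ab) = a D_ℓ(b) + b D_ℓ(a)`. [cite: GortzWedhorn2023, Prop. 17.43 and Rem. 27.18 (4)] -/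
theorem invDerivApp_mul (a b : Γ(A.X.left, U)) :
    invDerivApp hU ℓ hℓs hℓK hℓ2 (a * b) =
      a * invDerivApp hU ℓ hℓs hℓK hℓ2 b + b * invDerivApp hU ℓ hℓs hℓK hℓ2 a := by
  rw [invDerivApp, invDerivApp, invDerivApp, map_mul, snd_mul, fst_fieldPull, fst_fieldPull, smul_eq_mul,
    MulOpposite.smul_eq_mul_unop, MulOpposite.unop_op, mul_comm _ b]

/-- **`D_ℓ` kills the constants**: `D_ℓ(c) = 0` for `c ∈ K` (the field point is a morphism over `K`). [cite: GortzWedhorn2023, Prop. 17.43 and Rem. 27.18 (4)] -/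
theorem invDerivApp_secHom (c : K) : invDerivApp hU ℓ hℓs hℓK hℓ2 (secHom U c) = 0 := by
  rw [invDerivApp, fieldPull, pullSec_secHom (fieldPt hU ℓ hℓs hℓK hℓ2)]
  exact snd_inl _ _

/-! #### Naturality in the affine open -/

/-- Restriction of sections `Γ(A, U) → Γ(A, V)` for `V ≤ U`. [cite: GortzWedhorn2020, (3.4)–(3.5) (schemes over a ring; Hartshorne II Ex. 2.4)] -/
abbrev resHom {U V : A.X.left.Opens} (i : V ≤ U) : Γ(A.X.left, U) →+* Γ(A.X.left, V) :=
  (A.X.left.presheaf.map (homOfLE i).op).hom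

/-- Restriction preserves the constants. [cite: GortzWedhorn2020, (3.4)–(3.5) (schemes over a ring; Hartshorne II Ex. 2.4)] -/
theorem resHom_comp_secHom {U V : A.X.left.Opens} (i : V ≤ U) : (resHom i).comp (secHom U) = secHom (A := A) V := by
  have := (constToPresheaf A.X).naturality (homOfLE i).op
  simp only [Functor.const_obj_map] at this
  exact congrArg CommRingCat.Hom.hom this.symm

/-- The field point of `V ≤ U` is the field point of `U` composed with `Spec` of the restriction. [cite: GortzWedhorn2023, Rem. 27.1 and Rem. 27.18 (4)] -/
theorem fieldPt_res {V : A.X.left.Opens} (hV : IsAffineOpen V) (i : V ≤ U) :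
    fieldPt hV ℓ hℓs hℓK hℓ2 = specOfMap (secDualHom U) (secDualHom V) (dualNumberMap (resHom i))
      (by rw [secDualHom, ← RingHom.comp_assoc, dualNumberMap_comp_inlHom, RingHom.comp_assoc,
        resHom_comp_secHom]) ≫ fieldPt hU ℓ hℓs hℓK hℓ2 := by
  rw [fieldPt, fieldPt, MonObj.comp_mul]
  congr 1
  · apply Over.OverMorphism.ext
    rw [Over.comp_left, specOfMap_left, chartLift, chartLift, Over.comp_left, Over.comp_left, chartPt_left,
      chartPt_left, secIncl, secIncl, specOfMap_left, specOfMap_left]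
    change Spec.map _ ≫ hV.fromSpec = Spec.map _ ≫ Spec.map _ ≫ hU.fromSpec
    rw [← Spec.map_comp_assoc, ← CommRingCat.ofHom_comp, dualNumberMap_comp_inlHom, CommRingCat.ofHom_comp,
      Spec.map_comp_assoc]
    change _ = _ ≫ Spec.map (A.X.left.presheaf.map (homOfLE i).op) ≫ hU.fromSpec
    rw [IsAffineOpen.map_fromSpec hU hV]
  · apply Over.OverMorphism.ext
    rw [Over.comp_left, specOfMap_left, tangentPtOf_left, tangentPtOf_left]
    change _ = Spec.map _ ≫ ptOfStalkHom _
    rw [SpecMap_comp_ptOfStalkHom]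
    have ee : CommRingCat.ofHom (tangentHomOf (secHom U) ℓ hℓs hℓK hℓ2) ≫
        CommRingCat.ofHom (dualNumberMap (resHom i)) =
        CommRingCat.ofHom (tangentHomOf (secHom (A := A) V) ℓ hℓs hℓK hℓ2) := by
      rw [← CommRingCat.ofHom_comp, dualNumberMap_comp_tangentHomOf, resHom_comp_secHom]
    exact congrArg ptOfStalkHom ee.symm

/-- **Naturality of `D_ℓ` under restriction to a smaller affine open**: `D_ℓ(b|_V) = D_ℓ(b)|_V`. [cite: GortzWedhorn2023, Prop. 17.43 and Rem. 27.18 (4)] -/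
theorem invDerivApp_res {V : A.X.left.Opens} (hV : IsAffineOpen V) (i : V ≤ U) (b : Γ(A.X.left, U)) :
    invDerivApp hV ℓ hℓs hℓK hℓ2 (resHom i b) = resHom i (invDerivApp hU ℓ hℓs hℓK hℓ2 b) := by
  have hVU : ⊤ ≤ (fieldPt hV ℓ hℓs hℓK hℓ2).left ⁻¹ᵁ U :=
    (fieldPt_preimage hV ℓ hℓs hℓK hℓ2).trans ((Opens.map _).map (homOfLE i)).le
  have e := fieldPt_res hU ℓ hℓs hℓK hℓ2 hV i
  have e' : (fieldPt hV ℓ hℓs hℓK hℓ2).left =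
      Spec.map (CommRingCat.ofHom (dualNumberMap (resHom i))) ≫ (fieldPt hU ℓ hℓs hℓK hℓ2).left :=
    congrArg CommaMorphism.left e
  rw [invDerivApp, invDerivApp, fieldPull, fieldPull, pullSec_map _ i hVU,
    pullSec_congr e' U hVU (by rw [← e']; exact hVU),
    pullSec_SpecMap_comp _ _ U (fieldPt_preimage hU ℓ hℓs hℓK hℓ2), CommRingCat.hom_ofHom, RingHom.comp_apply,
    snd_dualNumberMap]

/-! #### The value of `D_ℓ(b)` at a point is the translated derivation of the germ of `b` -/

variable {L : Type u} [Field L] [Algebra K L] (x : A.X.left) (ξ : specOver K L ⟶ A.X) (hξ : basePt ξ = x)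

include hξ in
/-- An `L`-point based at `x ∈ U` lands in `U`. [cite: GortzWedhorn2020, Exercise 3.18 and (6.4) Prop. 6.7 (morphisms Spec R → X, R local, through 𝒪_{X,x})] -/
theorem top_le_preimage_of_basePt (hxU : x ∈ U) : ⊤ ≤ ξ.left ⁻¹ᵁ U :=
  (Scheme.preimage_eq_top_of_closedPoint_mem ξ.left (hξ ▸ hxU : basePt ξ ∈ U)).ge

/-- **Evaluation at an `L`-point**: `Γ(A, U) → L`, `b ↦ b(ξ)`. [cite: GortzWedhorn2020, Exercise 3.18 and (6.4) Prop. 6.7 (morphisms Spec R → X, R local, through 𝒪_{X,x})] -/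
def evalPt (hxU : x ∈ U) : Γ(A.X.left, U) →+* L :=
  pullSec (R := CommRingCat.of L) ξ.left U (top_le_preimage_of_basePt x ξ hξ hxU)

/-- Evaluation is `K`-linear on constants: `c(ξ) = c`. [cite: GortzWedhorn2020, (3.4)–(3.5) (schemes over a ring; Hartshorne II Ex. 2.4)] -/
theorem evalPt_secHom (hxU : x ∈ U) (c : K) : evalPt x ξ hξ hxU (secHom U c) = algebraMap K L c :=
  pullSec_secHom (s' := algebraMap K L) ξ _ c

/-- Evaluation at `ξ` is the germ at `x` followed by the local homomorphism of `ξ`. [cite: GortzWedhorn2020, Exercise 3.18 and (6.4) Prop. 6.7 (morphisms Spec R → X, R local, through 𝒪_{X,x})] -/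
theorem evalPt_eq_evBase (hxU : x ∈ U) (b : Γ(A.X.left, U)) :
    evalPt x ξ hξ hxU b = evBase x ξ hξ (A.X.left.presheaf.germ U x hxU b) :=
  pullSec_eq_evAtPt (R := CommRingCat.of L) ξ.left hξ hxU _ b

/-- The `L[ε]`-point `Spec L[ε] → Spec Γ(A,U)[ε] →(field point) A` obtained by evaluating at `ξ` is the
translate `ξ₀ · t_ℓ` of the `L`-valued tangent vector (naturality of the Yoneda group structure,
Görtz–Wedhorn II, Rem. 27.1). [cite: GortzWedhorn2023, Rem. 27.1 and Rem. 27.18 (4)] -/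
theorem specOfMap_evalPt_comp_fieldPt (hxU : x ∈ U) :
    (specOfMap (secDualHom U) ((inlHom L L).comp (algebraMap K L)) (dualNumberMap (evalPt x ξ hξ hxU))
        (by rw [secDualHom, ← RingHom.comp_assoc, dualNumberMap_comp_inlHom, RingHom.comp_assoc]
            exact congrArg _ (RingHom.ext (evalPt_secHom x ξ hξ hxU))) :
      specOver K (DualNumber L) ⟶ specOf K (secDualHom U)) ≫ fieldPt hU ℓ hℓs hℓK hℓ2 =
      liftPt ξ * tangentPtOfAlg L ℓ hℓs hℓK hℓ2 := by
  rw [fieldPt, MonObj.comp_mul]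
  congr 1
  · -- the chart part: `Spec L[ε] → Spec L → A` is the constant lift of `ξ`
    apply Over.OverMorphism.ext
    rw [Over.comp_left, specOfMap_left, chartLift, Over.comp_left, chartPt_left, secIncl, specOfMap_left,
      liftPt, Over.comp_left, specOverMapOfAlgHom_left]
    change Spec.map _ ≫ Spec.map _ ≫ hU.fromSpec = Spec.map _ ≫ ξ.left
    rw [← Spec.map_comp_assoc, ← CommRingCat.ofHom_comp, dualNumberMap_comp_inlHom, CommRingCat.ofHom_comp,
      Spec.map_comp_assoc]
    have h := top_le_preimage_of_basePt x ξ hξ hxU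
    have key : Spec.map (CommRingCat.ofHom (evalPt x ξ hξ hxU)) ≫ hU.fromSpec = ξ.left := by
      have h1 : Spec.map (ξ.left.appLE U ⊤ h) ≫ hU.fromSpec =
          (isAffineOpen_top (Spec (CommRingCat.of L))).fromSpec ≫ ξ.left :=
        IsAffineOpen.SpecMap_appLE_fromSpec ξ.left hU (isAffineOpen_top (Spec (CommRingCat.of L))) h
      rw [IsAffineOpen.fromSpec_top, Scheme.isoSpec_Spec_inv] at h1
      have h2 : CommRingCat.ofHom (evalPt x ξ hξ hxU) =
          ξ.left.appLE U ⊤ h ≫ (Scheme.ΓSpecIso (CommRingCat.of L)).hom := rfl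
      rw [h2, Spec.map_comp_assoc, h1, ← Spec.map_comp_assoc, Iso.inv_hom_id, Spec.map_id,
        Category.id_comp]
    rw [key]
    rfl
  · -- the tangent part: functoriality of the tangent vector in the coefficient ring
    apply Over.OverMorphism.ext
    rw [Over.comp_left, specOfMap_left, tangentPtOf_left]
    change Spec.map _ ≫ ptOfStalkHom _ = _
    rw [SpecMap_comp_ptOfStalkHom]
    have hs : (evalPt x ξ hξ hxU).comp (secHom U) = algebraMap K L := RingHom.ext (evalPt_secHom x ξ hξ hxU)
    have ee : CommRingCat.ofHom (tangentHomOf (secHom U) ℓ hℓs hℓK hℓ2) ≫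
        CommRingCat.ofHom (dualNumberMap (evalPt x ξ hξ hxU)) =
        CommRingCat.ofHom (tangentHomOfAlg L ℓ hℓs hℓK hℓ2) := by
      rw [← CommRingCat.ofHom_comp, dualNumberMap_comp_tangentHomOf, hs]
    exact congrArg ptOfStalkHom ee

/-- **The value of `D_ℓ(b)` at a point `x ∈ U` is the translated derivation of the germ of `b`**: for
every field `L ⊇ K` and `L`-point `ξ` based at `x`, `(D_ℓ b)(ξ) = ∂_{ξ₀ · t_ℓ}(b_x)`. This links the
global vector field to `linearIndependent_translatedDerivation`. [cite: GortzWedhorn2023, Rem. 27.1 and Rem. 27.18 (4)] -/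
theorem evalPt_invDerivApp (hxU : x ∈ U) (b : Γ(A.X.left, U)) :
    evalPt x ξ hξ hxU (invDerivApp hU ℓ hℓs hℓK hℓ2 b) =
      translatedDerivation x ξ hξ (tangentPtOfAlg L ℓ hℓs hℓK hℓ2) (tangentPtOfAlg_mem L ℓ hℓs hℓK hℓ2)
        (A.X.left.presheaf.germ U x hxU b) := by
  have e : Spec.map (CommRingCat.ofHom (dualNumberMap (evalPt x ξ hξ hxU))) ≫ (fieldPt hU ℓ hℓs hℓK hℓ2).left =
      (liftPt ξ * tangentPtOfAlg L ℓ hℓs hℓK hℓ2).left :=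
    congrArg CommaMorphism.left (specOfMap_evalPt_comp_fieldPt hU ℓ hℓs hℓK hℓ2 x ξ hξ hxU)
  have hP := aug_comp_liftPt_mul ξ _ (tangentPtOfAlg_mem L ℓ hℓs hℓK hℓ2)
  have hb : ⊤ ≤ (liftPt ξ * tangentPtOfAlg L ℓ hℓs hℓK hℓ2).left ⁻¹ᵁ U :=
    (Scheme.preimage_eq_top_of_closedPoint_mem _
      ((basePt_eq_of_aug_comp_eq' x ξ hξ hP).symm ▸ hxU : basePt (liftPt ξ * tangentPtOfAlg L ℓ hℓs hℓK hℓ2) ∈ U)).ge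
  have h1 : evalPt x ξ hξ hxU (invDerivApp hU ℓ hℓs hℓK hℓ2 b) =
      (dualNumberMap (evalPt x ξ hξ hxU) (fieldPull hU ℓ hℓs hℓK hℓ2 b)).snd := by
    rw [snd_dualNumberMap]; rfl
  have h2 := pullSec_SpecMap_comp (R := CommRingCat.of (DualNumber Γ(A.X.left, U)))
    (S := CommRingCat.of (DualNumber L)) (CommRingCat.ofHom (dualNumberMap (evalPt x ξ hξ hxU)))
    (fieldPt hU ℓ hℓs hℓK hℓ2).left U (fieldPt_preimage hU ℓ hℓs hℓK hℓ2) (by rw [e]; exact hb)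
  rw [CommRingCat.hom_ofHom] at h2
  rw [h1, fieldPull, ← RingHom.comp_apply, ← h2, pullSec_congr e U _ hb,
    pullSec_eq_evAtPt (R := CommRingCat.of (DualNumber L)) _ (basePt_eq_of_aug_comp_eq' x ξ hξ hP) hxU hb]
  rfl

end AffineDerivation

/-! ### The invariant derivation on all opens: extension from the affine basis -/

section GlobalDerivation

variable (ℓ : stalkOrigin A →+ K)
  (hℓs : ∀ (c : K) (a : stalkOrigin A), ℓ (stalkOriginAlgebraMap A c * a) = c * ℓ a)
  (hℓK : ∀ c : K, ℓ (stalkOriginAlgebraMap A c) = 0)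
  (hℓ2 : ∀ x ∈ IsLocalRing.maximalIdeal (stalkOrigin A) ^ 2, ℓ x = 0)

variable (A) in
/-- The structure sheaf of `A` as a sheaf of types. [cite: GortzWedhorn2020, (3.4)–(3.5) (schemes over a ring; Hartshorne II Ex. 2.4)] -/
def structureSheafType : TopCat.Sheaf (Type u) A.X.left.carrier :=
  ⟨A.X.left.presheaf ⋙ forget CommRingCat,
    (TopCat.Presheaf.isSheaf_iff_isSheaf_comp (forget CommRingCat) A.X.left.presheaf).mp A.X.left.sheaf.2⟩

variable (A) in
/-- The affine opens of `A`, as a family indexing a basis of the topology. [cite: GortzWedhorn2020, (3.4)–(3.5) (schemes over a ring; Hartshorne II Ex. 2.4)] -/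
abbrev affineBasis : A.X.left.affineOpens → A.X.left.Opens := fun U => U.1

/-- Members of the affine basis are affine. [cite: GortzWedhorn2020, (3.4)–(3.5) (schemes over a ring; Hartshorne II Ex. 2.4)] -/
theorem affineBasis_isAffineOpen (U : InducedCategory A.X.left.Opens (affineBasis A)) :
    IsAffineOpen (affineBasis A U) := U.2

/-- The affine opens form a basis (Mathlib `Scheme.isBasis_affineOpens`). [cite: GortzWedhorn2020, (3.4)–(3.5) (schemes over a ring; Hartshorne II Ex. 2.4)] -/
theorem isBasis_range_affineBasis : Opens.IsBasis (Set.range (affineBasis A)) := by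
  have h : Set.range (affineBasis A) = A.X.left.affineOpens := Subtype.range_coe
  rw [h]
  exact A.X.left.isBasis_affineOpens

/-- The invariant derivations on the affine opens, as a natural endomorphism of the structure sheaf of
types restricted to the affine basis (naturality = `invDerivApp_res`). [cite: GortzWedhorn2023, Prop. 17.43 and Rem. 27.18 (4)] -/
def invDerivAppNatTrans :
    (inducedFunctor (affineBasis A)).op ⋙ (structureSheafType A).1 ⟶
      (inducedFunctor (affineBasis A)).op ⋙ (structureSheafType A).1 where
  app U := TypeCat.ofHom fun b => invDerivApp (affineBasis_isAffineOpen U.unop) ℓ hℓs hℓK hℓ2 b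
  naturality U V f := by
    apply ConcreteCategory.hom_ext
    intro b
    have e1 : ((inducedFunctor (affineBasis A)).map f.unop).op = (homOfLE f.unop.hom.le).op :=
      Subsingleton.elim _ _
    change invDerivApp _ ℓ hℓs hℓK hℓ2 (A.X.left.presheaf.map ((inducedFunctor (affineBasis A)).map f.unop).op b) =
      A.X.left.presheaf.map ((inducedFunctor (affineBasis A)).map f.unop).op (invDerivApp _ ℓ hℓs hℓK hℓ2 b)
    rw [e1]
    exact invDerivApp_res (affineBasis_isAffineOpen U.unop) ℓ hℓs hℓK hℓ2
      (affineBasis_isAffineOpen V.unop) f.unop.hom.le b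

/-- **The left-invariant vector field `D_ℓ`** as an endomorphism of the structure sheaf of types of `A`:
the unique extension of the affine-local derivations `invDerivApp` from the basis of affine opens
(Mathlib `TopCat.Sheaf.restrictHomEquivHom`; Görtz–Wedhorn II, (17.6.1): `𝒯_{X/S}` is a sheaf).
[cite: GortzWedhorn2023, Prop. 17.43 and Rem. 27.18 (4)] [cite: MumfordAV1970, §4 (iii) (p. 42)] -/
def invDerivNatTrans : (structureSheafType A).1 ⟶ (structureSheafType A).1 :=
  TopCat.Sheaf.restrictHomEquivHom (structureSheafType A).1 (structureSheafType A) isBasis_range_affineBasis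
    (invDerivAppNatTrans ℓ hℓs hℓK hℓ2)

/-- `D_ℓ` on the sections over an arbitrary open `U`. [cite: GortzWedhorn2023, Prop. 17.43 and Rem. 27.18 (4)] [cite: MumfordAV1970, §4 (iii) (p. 42)] -/
def invDeriv (U : A.X.left.Opens) (b : Γ(A.X.left, U)) : Γ(A.X.left, U) :=
  (invDerivNatTrans ℓ hℓs hℓK hℓ2).app (op U) b

/-- On an affine open, `D_ℓ` is `invDerivApp`. [cite: GortzWedhorn2023, Prop. 17.43 and Rem. 27.18 (4)] -/
theorem invDeriv_eq_invDerivApp {U : A.X.left.Opens} (hU : IsAffineOpen U) (b : Γ(A.X.left, U)) :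
    invDeriv ℓ hℓs hℓK hℓ2 U b = invDerivApp hU ℓ hℓs hℓK hℓ2 b := by
  have h := TopCat.Sheaf.extend_hom_app (structureSheafType A).1 (structureSheafType A)
    isBasis_range_affineBasis (invDerivAppNatTrans ℓ hℓs hℓK hℓ2) ⟨U, hU⟩
  exact CategoryTheory.types_congr_hom h b

/-- `D_ℓ` commutes with restriction. [cite: GortzWedhorn2023, Prop. 17.43 and Rem. 27.18 (4)] -/
theorem invDeriv_map {U V : A.X.left.Opens} (i : V ≤ U) (b : Γ(A.X.left, U)) :
    invDeriv ℓ hℓs hℓK hℓ2 V (resHom i b) = resHom i (invDeriv ℓ hℓs hℓK hℓ2 U b) :=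
  CategoryTheory.types_congr_hom ((invDerivNatTrans ℓ hℓs hℓK hℓ2).naturality (homOfLE i).op) b

/-- Two sections agreeing on all affine opens below `U` are equal (the affine opens cover `U`). [cite: GortzWedhorn2020, (3.4)–(3.5) (schemes over a ring; Hartshorne II Ex. 2.4)] -/
theorem eq_of_res_affine_eq {U : A.X.left.Opens} (s t : Γ(A.X.left, U))
    (h : ∀ (V : A.X.left.Opens) (hV : IsAffineOpen V) (i : V ≤ U), resHom i s = resHom i t) : s = t := by
  let Idx := {V : A.X.left.affineOpens // (V : A.X.left.Opens) ≤ U}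
  refine TopCat.Sheaf.eq_of_locally_eq' A.X.left.sheaf (fun i : Idx => (i.1 : A.X.left.Opens)) U
    (fun i => homOfLE i.2) ?_ s t (fun i => h _ i.1.2 i.2)
  intro x hx
  obtain ⟨V, ⟨W, ⟨W', hW'⟩, hWV⟩, hxV, hVU⟩ :=
    isBasis_range_affineBasis.exists_subset_of_mem_open hx U.isOpen
  subst hWV; subst hW'
  exact Opens.mem_iSup.mpr ⟨⟨W', hVU⟩, hxV⟩

/-- `D_ℓ` is additive. [cite: GortzWedhorn2023, Prop. 17.43 and Rem. 27.18 (4)] -/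
theorem invDeriv_add (U : A.X.left.Opens) (a b : Γ(A.X.left, U)) :
    invDeriv ℓ hℓs hℓK hℓ2 U (a + b) = invDeriv ℓ hℓs hℓK hℓ2 U a + invDeriv ℓ hℓs hℓK hℓ2 U b := by
  apply eq_of_res_affine_eq; intro V hV i
  rw [map_add, ← invDeriv_map, ← invDeriv_map, ← invDeriv_map, map_add, invDeriv_eq_invDerivApp _ _ _ _ hV,
    invDeriv_eq_invDerivApp _ _ _ _ hV, invDeriv_eq_invDerivApp _ _ _ _ hV, invDerivApp_add]

/-- `D_ℓ(0) = 0`. [cite: GortzWedhorn2023, Prop. 17.43 and Rem. 27.18 (4)] -/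
theorem invDeriv_zero (U : A.X.left.Opens) : invDeriv ℓ hℓs hℓK hℓ2 U 0 = 0 := by
  have h := invDeriv_add ℓ hℓs hℓK hℓ2 U 0 0
  rw [add_zero] at h
  exact left_eq_add.mp h

/-- **Leibniz rule** for `D_ℓ` on every open. [cite: GortzWedhorn2023, Prop. 17.43 and Rem. 27.18 (4)] -/
theorem invDeriv_mul (U : A.X.left.Opens) (a b : Γ(A.X.left, U)) :
    invDeriv ℓ hℓs hℓK hℓ2 U (a * b) = a * invDeriv ℓ hℓs hℓK hℓ2 U b + b * invDeriv ℓ hℓs hℓK hℓ2 U a := by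
  apply eq_of_res_affine_eq; intro V hV i
  rw [← invDeriv_map, map_mul, map_add, map_mul, map_mul, ← invDeriv_map, ← invDeriv_map,
    invDeriv_eq_invDerivApp _ _ _ _ hV, invDeriv_eq_invDerivApp _ _ _ _ hV, invDeriv_eq_invDerivApp _ _ _ _ hV,
    invDerivApp_mul]

/-- **`D_ℓ` kills the constants** on every open. [cite: GortzWedhorn2023, Prop. 17.43 and Rem. 27.18 (4)] -/
theorem invDeriv_secHom (U : A.X.left.Opens) (c : K) : invDeriv ℓ hℓs hℓK hℓ2 U (secHom U c) = 0 := by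
  apply eq_of_res_affine_eq; intro V hV i
  rw [← invDeriv_map, map_zero, ← RingHom.comp_apply, resHom_comp_secHom, invDeriv_eq_invDerivApp _ _ _ _ hV,
    invDerivApp_secHom]

end GlobalDerivation

end AbelianVariety

end Literature.AlgebraicGeometry.Motives

end
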